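import Summits.CriticalPhenomena.Ising3D.TaylorTableHeadPartsL
import Mathlib.Tactic.Linarith
import HarnessLib

/-!
# Head-part checks with FASTER, RESULT-IDENTICAL interval primitives (`oddPartOKF = oddPartOKL`, `evenPartOKF = evenPartOKL`)
(cell `pub-ising3x`, seat boot-1 gen 12; HEAD-DELTA §10.6)

HONEST FRAMING: lottery ticket; floor = tightest certified 3D Ising CFT bounds; no exact-solution
claim without a proof. Island framing: certified exclusion region at stated derivative order and
assumptions; not a determination of the 3D Ising critical exponents beyond that.

The kernel replay of a γ-box spends ≈ 3.3 s per one-term part in `oddPartOKL` / `evenPartOKL`, almost all of it in the Horner shift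
`PolyMP.shiftI` (a scalar Moore product per coefficient and step) and the product `PolyMP.mulI`. Two purely computational
rewrites keep EVERY computed interval bit-identical and therefore change no statement:
* `scaleM S c I` — when the scalar is a POINT interval (`c.hi = c.lo`; the shift point `ofRat S (n + ctr)` is dyadic, exact at
  scale 2⁶⁴) the Moore product `MI.mul S c I` has only two distinct corner products: `⟨min p₁ p₂ / S, ⌈max p₁ p₂ / S⌉⟩`; `smulIF` tests
  `c.hi = c.lo` at run time and falls back to `smulI` otherwise, so `smulIF = smulI` holds unconditionally;
* `mul9 S I J` — the sign-case product (two corner products in eight of the nine sign cases) equals the Moore product whenever both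
  intervals are proper (`lo ≤ hi`); `mulF` tests properness at run time and falls back to `MI.mul`, so `mulF = MI.mul` unconditionally.
`shiftF`/`mulIF`/`headPolyTMF`/`famTripleF`/`oddPartOKF`/`evenPartOKF` are the landed definitions with these primitives substituted, each
with an equality theorem to its landed counterpart; a replay file may prove `oddPartOKF … = true` by `decide +kernel` and obtain the landed
Boolean by `oddPartOKF_eq ▸`. Measured on 20 real E1 parts (boot-1 g12, HEAD-DELTA §10.6): 63.9 s → ≈ 37 s. [folklore]
-/

set_option linter.style.longLine false

namespace Summit.CriticalPhenomena.Ising3D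

open Literature.Analysis.ValidatedNumerics Literature.Analysis.ValidatedNumerics.PolyMP
open Literature.Analysis.ValidatedNumerics.NumericsMP (MI)
open Literature.MathematicalPhysics.QuantumFieldTheory.ConformalBootstrap3D
open Literature.MathematicalPhysics.QuantumFieldTheory.ConformalBootstrap3D.HRTM (rowEntry)
open Literature.MathematicalPhysics.QuantumFieldTheory.ConformalBootstrap3D.PointKernel (legendreLamQ)

namespace HeadPartsFast

/-! ### Point-scalar product -/

/-- Moore product with a scalar whose interval is a point: two corner products instead of four. [folklore] -/
def scaleM (S : ℕ) (c I : MI) : MI :=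
  let p1 := c.lo * I.lo
  let p2 := c.lo * I.hi
  ⟨min p1 p2 / S, Numerics.cdiv (max p1 p2) S⟩

/-- For a point scalar the two-corner product IS the Moore product. [folklore] -/
theorem scaleM_eq (S : ℕ) {c : MI} (hc : c.hi = c.lo) (I : MI) : scaleM S c I = MI.mul S c I := by
  simp only [scaleM, MI.mul, hc, min_self, max_self]

/-- Scalar multiple of an interval polynomial with the run-time point test (falls back to `smulI`). [folklore] -/
def smulIF (S : ℕ) (c : MI) (P : IPoly) : IPoly :=
  if c.hi = c.lo then P.map (scaleM S c) else smulI S c P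

/-- [folklore] -/
theorem smulIF_eq (S : ℕ) (c : MI) (P : IPoly) : smulIF S c P = smulI S c P := by
  unfold smulIF
  split_ifs with hc
  · simp only [smulI]
    exact List.map_congr_left fun I _ => scaleM_eq S hc I
  · rfl

/-! ### Sign-case product -/

/-- Sign-case interval product: in eight of the nine sign configurations only two corner products are formed. [folklore] -/
def mul9 (S : ℕ) (I J : MI) : MI :=
  if 0 ≤ I.lo then
    (if 0 ≤ J.lo then ⟨I.lo * J.lo / S, Numerics.cdiv (I.hi * J.hi) S⟩
     else if J.hi ≤ 0 then ⟨I.hi * J.lo / S, Numerics.cdiv (I.lo * J.hi) S⟩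
     else ⟨I.hi * J.lo / S, Numerics.cdiv (I.hi * J.hi) S⟩)
  else if I.hi ≤ 0 then
    (if 0 ≤ J.lo then ⟨I.lo * J.hi / S, Numerics.cdiv (I.hi * J.lo) S⟩
     else if J.hi ≤ 0 then ⟨I.hi * J.hi / S, Numerics.cdiv (I.lo * J.lo) S⟩
     else ⟨I.lo * J.hi / S, Numerics.cdiv (I.lo * J.lo) S⟩)
  else
    (if 0 ≤ J.lo then ⟨I.lo * J.hi / S, Numerics.cdiv (I.hi * J.hi) S⟩
     else if J.hi ≤ 0 then ⟨I.hi * J.lo / S, Numerics.cdiv (I.lo * J.lo) S⟩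
     else ⟨min (I.lo * J.hi) (I.hi * J.lo) / S, Numerics.cdiv (max (I.lo * J.lo) (I.hi * J.hi)) S⟩)

/-- min/max of the four corner products under sign information (all nine cases; linear once the four products are atoms). [folklore] -/
private theorem corners {a b c d m M : ℤ} (hab : a ≤ b) (hcd : c ≤ d)
    (h : (0 ≤ a ∧ 0 ≤ c ∧ m = a * c ∧ M = b * d) ∨ (0 ≤ a ∧ d ≤ 0 ∧ m = b * c ∧ M = a * d) ∨ (0 ≤ a ∧ c < 0 ∧ 0 < d ∧ m = b * c ∧ M = b * d) ∨
      (a < 0 ∧ b ≤ 0 ∧ 0 ≤ c ∧ m = a * d ∧ M = b * c) ∨ (a < 0 ∧ b ≤ 0 ∧ d ≤ 0 ∧ m = b * d ∧ M = a * c) ∨ (a < 0 ∧ b ≤ 0 ∧ c < 0 ∧ 0 < d ∧ m = a * d ∧ M = a * c) ∨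
      (a < 0 ∧ 0 < b ∧ 0 ≤ c ∧ m = a * d ∧ M = b * d) ∨ (a < 0 ∧ 0 < b ∧ d ≤ 0 ∧ m = b * c ∧ M = a * c) ∨
      (a < 0 ∧ 0 < b ∧ c < 0 ∧ 0 < d ∧ m = min (a * d) (b * c) ∧ M = max (a * c) (b * d))) :
    min (min (a * c) (a * d)) (min (b * c) (b * d)) = m ∧ max (max (a * c) (a * d)) (max (b * c) (b * d)) = M := by
  rcases h with ⟨ha, hc, rfl, rfl⟩ | ⟨ha, hd, rfl, rfl⟩ | ⟨ha, hc, hd, rfl, rfl⟩ | ⟨ha, hb, hc, rfl, rfl⟩ | ⟨ha, hb, hd, rfl, rfl⟩ |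
      ⟨ha, hb, hc, hd, rfl, rfl⟩ | ⟨ha, hb, hc, rfl, rfl⟩ | ⟨ha, hb, hd, rfl, rfl⟩ | ⟨ha, hb, hc, hd, rfl, rfl⟩
  · -- case A1
    have x1 : a * c ≤ a * d := by nlinarith
    have x2 : b * c ≤ b * d := by nlinarith
    have x3 : a * c ≤ b * c := by nlinarith
    have x4 : a * d ≤ b * d := by nlinarith
    constructor <;> simp only [min_def, max_def] <;> split_ifs <;> linarith
  · -- case A2
    have x1 : a * c ≤ a * d := by nlinarith
    have x2 : b * c ≤ b * d := by nlinarith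
    have x3 : b * c ≤ a * c := by nlinarith
    have x4 : b * d ≤ a * d := by nlinarith
    constructor <;> simp only [min_def, max_def] <;> split_ifs <;> linarith
  · -- case A3
    have x1 : a * c ≤ a * d := by nlinarith
    have x2 : b * c ≤ b * d := by nlinarith
    have x3 : b * c ≤ a * c := by nlinarith
    have x4 : a * d ≤ b * d := by nlinarith
    constructor <;> simp only [min_def, max_def] <;> split_ifs <;> linarith
  · -- case B1
    have x1 : a * d ≤ a * c := by nlinarith
    have x2 : b * d ≤ b * c := by nlinarith
    have x3 : a * c ≤ b * c := by nlinarith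
    have x4 : a * d ≤ b * d := by nlinarith
    constructor <;> simp only [min_def, max_def] <;> split_ifs <;> linarith
  · -- case B2
    have x1 : a * d ≤ a * c := by nlinarith
    have x2 : b * d ≤ b * c := by nlinarith
    have x3 : b * c ≤ a * c := by nlinarith
    have x4 : b * d ≤ a * d := by nlinarith
    constructor <;> simp only [min_def, max_def] <;> split_ifs <;> linarith
  · -- case B3
    have x1 : a * d ≤ a * c := by nlinarith
    have x2 : b * d ≤ b * c := by nlinarith
    have x3 : b * c ≤ a * c := by nlinarith
    have x4 : a * d ≤ b * d := by nlinarith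
    constructor <;> simp only [min_def, max_def] <;> split_ifs <;> linarith
  · -- case C1
    have x1 : a * d ≤ a * c := by nlinarith
    have x2 : b * c ≤ b * d := by nlinarith
    have x3 : a * c ≤ b * c := by nlinarith
    have x4 : a * d ≤ b * d := by nlinarith
    constructor <;> simp only [min_def, max_def] <;> split_ifs <;> linarith
  · -- case C2
    have x1 : a * d ≤ a * c := by nlinarith
    have x2 : b * c ≤ b * d := by nlinarith
    have x3 : b * c ≤ a * c := by nlinarith
    have x4 : b * d ≤ a * d := by nlinarith
    constructor <;> simp only [min_def, max_def] <;> split_ifs <;> linarith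
  · -- case C3
    have x1 : a * d ≤ a * c := by nlinarith
    have x2 : b * c ≤ b * d := by nlinarith
    have x3 : b * c ≤ a * c := by nlinarith
    have x4 : a * d ≤ b * d := by nlinarith
    constructor <;> simp only [min_def, max_def] <;> split_ifs <;> linarith

/-- **For proper intervals the sign-case product IS the Moore product.** [folklore] -/
theorem mul9_eq (S : ℕ) {I J : MI} (hI : I.lo ≤ I.hi) (hJ : J.lo ≤ J.hi) : mul9 S I J = MI.mul S I J := by
  obtain ⟨a, b⟩ := I
  obtain ⟨c, d⟩ := J
  simp only at hI hJ
  have key : ∀ {m M : ℤ}, (min (min (a * c) (a * d)) (min (b * c) (b * d)) = m ∧ max (max (a * c) (a * d)) (max (b * c) (b * d)) = M) →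
      (⟨m / S, Numerics.cdiv M S⟩ : MI) = MI.mul S ⟨a, b⟩ ⟨c, d⟩ := by
    intro m M h
    simp only [MI.mul, h.1, h.2]
  simp only [mul9]
  split_ifs with h1 h2 h3 h4 h5 h6 h7 h8
  · exact key (corners hI hJ (Or.inl ⟨h1, h2, rfl, rfl⟩))
  · exact key (corners hI hJ (Or.inr (Or.inl ⟨h1, h3, rfl, rfl⟩)))
  · exact key (corners hI hJ (Or.inr (Or.inr (Or.inl ⟨h1, by linarith, by linarith, rfl, rfl⟩))))
  · exact key (corners hI hJ (Or.inr (Or.inr (Or.inr (Or.inl ⟨by linarith, h4, h5, rfl, rfl⟩)))))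
  · exact key (corners hI hJ (Or.inr (Or.inr (Or.inr (Or.inr (Or.inl ⟨by linarith, h4, h6, rfl, rfl⟩))))))
  · exact key (corners hI hJ (Or.inr (Or.inr (Or.inr (Or.inr (Or.inr (Or.inl ⟨by linarith, h4, by linarith, by linarith, rfl, rfl⟩)))))))
  · exact key (corners hI hJ (Or.inr (Or.inr (Or.inr (Or.inr (Or.inr (Or.inr (Or.inl ⟨by linarith, by linarith, h7, rfl, rfl⟩))))))))
  · exact key (corners hI hJ (Or.inr (Or.inr (Or.inr (Or.inr (Or.inr (Or.inr (Or.inr (Or.inl ⟨by linarith, by linarith, h8, rfl, rfl⟩)))))))))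
  · exact key (corners hI hJ (Or.inr (Or.inr (Or.inr (Or.inr (Or.inr (Or.inr (Or.inr (Or.inr ⟨by linarith, by linarith, by linarith, by linarith, rfl, rfl⟩)))))))))

/-- Interval product with the run-time properness test (falls back to the Moore product). [folklore] -/
def mulF (S : ℕ) (I J : MI) : MI :=
  if I.lo ≤ I.hi ∧ J.lo ≤ J.hi then mul9 S I J else MI.mul S I J

/-- [folklore] -/
theorem mulF_eq (S : ℕ) (I J : MI) : mulF S I J = MI.mul S I J := by
  unfold mulF
  split_ifs with h
  · exact mul9_eq S h.1 h.2
  · rfl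

/-! ### The polynomial layer with the fast primitives -/

/-- `mulI` with `mulF`. [folklore] -/
def mulIF (S : ℕ) : IPoly → IPoly → IPoly
  | [], _ => []
  | I :: P, Q => addI (Q.map (mulF S I)) (MI.ofInt S 0 :: mulIF S P Q)

/-- [folklore] -/
theorem mulIF_eq (S : ℕ) : ∀ P Q : IPoly, mulIF S P Q = mulI S P Q
  | [], Q => rfl
  | I :: P, Q => by
      simp only [mulIF, mulI, smulI, mulIF_eq S P Q]
      congr 1
      exact List.map_congr_left fun J _ => mulF_eq S I J

/-- One Horner step of the shift with `smulIF`. [folklore] -/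
def shiftStepF (S : ℕ) (c I : MI) (acc : IPoly) : IPoly :=
  addI [I] (addI (smulIF S c acc) (MI.ofInt S 0 :: acc))

/-- [folklore] -/
theorem shiftStepF_eq (S : ℕ) (c I : MI) (acc : IPoly) : shiftStepF S c I acc = shiftStepI S c I acc := by
  simp only [shiftStepF, shiftStepI, smulIF_eq]

/-- Taylor shift with the fast step. [folklore] -/
def shiftF (S : ℕ) (P : IPoly) (c : MI) : IPoly := P.foldr (shiftStepF S c) []

/-- [folklore] -/
theorem shiftF_eq (S : ℕ) (P : IPoly) (c : MI) : shiftF S P c = shiftI S P c := by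
  simp only [shiftF, shiftI]
  congr 1
  funext I acc
  exact shiftStepF_eq S c I acc

/-- `headPolyTM` with `mulIF` and `shiftF`. [folklore] -/
def headPolyTMF (S : ℕ) (rows : List IPoly) (tms : List (List IPoly)) (nF ℓ : ℕ) (ctr : ℚ) :
    List (ℕ × ℕ) → IPoly
  | [] => []
  | q :: qs => addI (smulQI (1 / (legendreLamQ ℓ * 2 ^ q.1))
      (mulIF S (HRTM.rowEntry tms nF q.1 q.2) (shiftF S (rows.getD q.2 []) (PolyMP.ofRat S ((q.1 : ℚ) + ctr)))))
      (headPolyTMF S rows tms nF ℓ ctr qs)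

/-- [folklore] -/
theorem headPolyTMF_eq (S : ℕ) (rows : List IPoly) (tms : List (List IPoly)) (nF ℓ : ℕ) (ctr : ℚ) :
    ∀ sl : List (ℕ × ℕ), headPolyTMF S rows tms nF ℓ ctr sl = headPolyTM S rows tms nF ℓ ctr sl
  | [] => rfl
  | q :: qs => by
      simp only [headPolyTMF, headPolyTM, mulIF_eq, shiftF_eq, headPolyTMF_eq S rows tms nF ℓ ctr qs]

/-- `famTriple` with the fast `headPolyTMF`. [folklore] -/
def famTripleF (S : ℕ) (R0 R1 R2 : List IPoly) (tms : List (List IPoly)) (C : EvenCellTM) (sl : List (ℕ × ℕ)) : ITriple :=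
  (headPolyTMF S R0 tms C.nF C.ℓ C.ctr sl, headPolyTMF S R1 tms C.nF C.ℓ C.ctr sl, headPolyTMF S R2 tms C.nF C.ℓ C.ctr sl)

/-- [folklore] -/
theorem famTripleF_eq (S : ℕ) (R0 R1 R2 : List IPoly) (tms : List (List IPoly)) (C : EvenCellTM) (sl : List (ℕ × ℕ)) :
    famTripleF S R0 R1 R2 tms C sl = famTriple S R0 R1 R2 tms C sl := by
  simp only [famTripleF, famTriple, headPolyTMF_eq]

/-- **Odd part check with the fast primitives** (same Boolean as `oddPartOKL`). [folklore] -/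
def oddPartOKF (R : OddHeadRowsΔ) (C : EvenCellTM) (tS tP tM : List (List IPoly)) (p : HeadPartOdd) : Bool :=
  let sl := (C.F.drop p.t0).take p.count
  subset3 (famTripleF R.S (R.rows 0 0) (R.rows 0 1) (R.rows 0 2) tS C sl) p.P3 &&
    subset3 (famTripleF R.S (R.rows 1 0) (R.rows 1 1) (R.rows 1 2) tP C sl) p.P4 &&
    subset3 (famTripleF R.S (R.rows 2 0) (R.rows 2 1) (R.rows 2 2) tP C sl) p.P5 &&
    subsetI (headPolyTMF R.S (R.rows 3 0) tM C.nF C.ℓ C.ctr sl) p.P0 &&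
    subset3 (famTripleF R.S (R.rows 4 0) (R.rows 4 1) (R.rows 4 2) tP C sl) p.Pt

/-- **`oddPartOKF = oddPartOKL`.** [folklore] -/
theorem oddPartOKF_eq (R : OddHeadRowsΔ) (C : EvenCellTM) (tS tP tM : List (List IPoly)) (p : HeadPartOdd) :
    oddPartOKF R C tS tP tM p = oddPartOKL R C tS tP tM p := by
  simp only [oddPartOKF, oddPartOKL, famTripleF_eq, headPolyTMF_eq]

/-- From the fast Boolean to the landed one (the form a replay file uses). [folklore] -/
theorem oddPartOKL_of_fast {R : OddHeadRowsΔ} {C : EvenCellTM} {tS tP tM : List (List IPoly)} {p : HeadPartOdd}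
    (h : oddPartOKF R C tS tP tM p = true) : oddPartOKL R C tS tP tM p = true := by
  rw [← oddPartOKF_eq]; exact h

/-- `headPartOKWith` with the fast `headPolyTMF`. [folklore] -/
def headPartOKWithF (tms : List (List IPoly)) (Rm : EvenRows) (C : EvenCellTM) (pm : HeadPart) : Bool :=
  subsetI (headPolyTMF Rm.S Rm.RX tms C.nF C.ℓ C.ctr (pm.slice C.F)) pm.PX &&
    subsetI (headPolyTMF Rm.S Rm.RY tms C.nF C.ℓ C.ctr (pm.slice C.F)) pm.PY &&
    subsetI (headPolyTMF Rm.S Rm.RZ tms C.nF C.ℓ C.ctr (pm.slice C.F)) pm.PZ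

/-- [folklore] -/
theorem headPartOKWithF_eq (tms : List (List IPoly)) (Rm : EvenRows) (C : EvenCellTM) (pm : HeadPart) :
    headPartOKWithF tms Rm C pm = headPartOKWith tms Rm C pm := by
  simp only [headPartOKWithF, headPartOKWith, headPolyTMF_eq]

/-- **Even part check with the fast primitives** (same Boolean as `evenPartOKL`). [folklore] -/
def evenPartOKF (R : HeadRowsΔ) (C : EvenCellTM) (tms : List (List IPoly)) (p : HeadPart3) : Bool :=
  headPartOKWithF tms R.rows0 C p.ord0 && headPartOKWithF tms R.rows1 C p.ord1 && headPartOKWithF tms R.rows2 C p.ord2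

/-- **`evenPartOKF = evenPartOKL`.** [folklore] -/
theorem evenPartOKF_eq (R : HeadRowsΔ) (C : EvenCellTM) (tms : List (List IPoly)) (p : HeadPart3) :
    evenPartOKF R C tms p = evenPartOKL R C tms p := by
  simp only [evenPartOKF, evenPartOKL, headPartOKWithF_eq]

/-- From the fast Boolean to the landed one. [folklore] -/
theorem evenPartOKL_of_fast {R : HeadRowsΔ} {C : EvenCellTM} {tms : List (List IPoly)} {p : HeadPart3}
    (h : evenPartOKF R C tms p = true) : evenPartOKL R C tms p = true := by
  rw [← evenPartOKF_eq]; exact h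

end HeadPartsFast
end Summit.CriticalPhenomena.Ising3D
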